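import Mathlib
import Literature.NumberTheory.DiophantineGeometry.AVGaloisModule
import Literature.NumberTheory.DiophantineGeometry.AbelianVarietyOrdinaryReduction
import Literature.NumberTheory.GaloisRepresentations.CrystallineOrdinaryShape
import Literature.NumberTheory.GaloisRepresentations.GaloisRep
import Literature.NumberTheory.GaloisRepresentations.LocalClassFieldTheoryProofs
import Literature.NumberTheory.GaloisRepresentations.WeilGroupDensityProofs
import Literature.NumberTheory.GaloisRepresentations.SerreWeightShapeProofs
import Literature.NumberTheory.Automorphic.LieKolchin
import Literature.NumberTheory.Automorphic.AdicCompletionLocalField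
import Mathlib.NumberTheory.Padics.Complex
import HarnessLib

/-!
# Stub `stub_tateModuleGreenberg` (line `level-three-weierstrass-switch`, crux stmt-Langlands-13640)

`B/ℚ` an abelian surface (`dim B = 2`) with good ordinary reduction at the place `v ∣ p`, `b` a
`ℚ_p`-basis of `V_p(B)` and `ρ₀ : Γ_ℚ → GL₄(ℚ̄_p)` the framed contragredient `H¹_ét(B_ℚ̄, ℚ̄_p)`
(`ρ₀(g) = [g⁻¹]_bᵀ`).  Then `ρ₀` is Greenberg-ordinary of shape `(0,0,1,1)` at `v`
(`FramedGaloisRep.IsGreenbergOrdinaryOfShapeAt`, CrystallineOrdinaryShape.lean) — the registered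
signature, proved here CONDITIONALLY on the published fact

* `ordinaryReduction_tateModule_filtration` (Serre–Tate / Tate / Grothendieck, in Greenberg's form):
  for good ordinary reduction at `v ∣ p`, `V_p(B)|_{Γ_{K_v}}` has a `Γ_{K_v}`-stable `ℚ_p`-subspace
  `W` of dimension `dim B` on which inertia acts through the cyclotomic character, inertia acting
  trivially on `V_p(B)/W` (the connected–étale sequence of `𝒜[p^∞]`).  The Galois-theoretic
  description of ordinary reduction is "a theorem, not recorded" in
  `AbelianVarietyOrdinaryReduction.lean`; it is stated below over tree vocabulary only.

Proof of the stub from the fact (all in this file).  Choose a `ℚ_p`-basis `b'` of `V_p(B)` whose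
last two vectors span `W` (`exists_basis_adapted`).  In `b'` the matrices `A'(σ)` of
`σ ∈ Γ_{ℚ_v}` have zero upper-right block, and for inertial `σ` they are `(1 0; * χ(σ))` in
`2 × 2` blocks; so the contragredient `N'(τ) = A'(τ⁻¹)ᵀ` (obtained from `ρ₀` by conjugating with
the transposed base-change matrix, `g₁`) is block UPPER triangular with inertia acting as `1` on the
first block and as the scalar `χ⁻¹ = ε⁻¹` on the second (`hN2`–`hN4`).  The two diagonal `2 × 2`
block families are multiplicative in `τ` and COMMUTATIVE: `τσ = [τ,σ]·στ` with `[Γ_{ℚ_v}, Γ_{ℚ_v}] ≤ I`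
(`commutatorElement_mem_absInertia`, from the tree's density of the Weil group) and inertia is
scalar on each block (`χ([τ,σ]) = 1`).  A commuting family of `2 × 2` matrices over the
algebraically closed `ℚ̄_p` is triangularisable (`exists_conj_upperTriangular_fin_two`, via the
tree's `exists_common_eigenvector_of_commute`), giving `X, Y ∈ GL₂(ℚ̄_p)`; the frame
`diag(X, Y) · g₁` is a Greenberg frame of shape `![0,0,1,1]` (unramified block first).  The only
definition in this file is the cited fact (a `Prop`).
-/

set_option linter.dupNamespace false

noncomputable section

open CategoryTheory IsDedekindDomain
open scoped NumberField commutatorElement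
open Literature.NumberTheory.GaloisRepresentations
open Literature.AlgebraicGeometry.Motives (AbelianVariety)

namespace Summit.Langlands.Langlands.Cruxes.StableYoshidaCongruence.LevelThreeWeierstrassSwitch

/-! ### The published fact (stated inline over tree vocabulary; the gate relocates it) -/

section TwoByTwo

variable {F : Type*} [Field F] [IsAlgClosed F]

/-- A commuting family of `2 × 2` matrices over an algebraically closed field has a common
eigenvector (the abelian case of Lie–Kolchin, tree `exists_common_eigenvector_of_commute`). [folklore] -/
theorem exists_common_eigenvector_fin_two (S : Set (Matrix (Fin 2) (Fin 2) F))
    (hS : ∀ s ∈ S, ∀ t ∈ S, s * t = t * s) :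
    ∃ v : Fin 2 → F, v ≠ 0 ∧ ∀ s ∈ S, ∃ c : F, s.mulVec v = c • v := by
  obtain ⟨v, -, hv0, hv⟩ :=
    Literature.NumberTheory.Automorphic.exists_common_eigenvector_of_commute
      (Matrix.toLin' '' S) ⊤ top_ne_bot (fun _ _ _ _ => trivial)
      (by
        rintro _ ⟨s, hs, rfl⟩ _ ⟨t, ht, rfl⟩ w -
        simp only [Matrix.toLin'_apply, Matrix.mulVec_mulVec, hS s hs t ht])
  exact ⟨v, hv0, fun s hs => by simpa using hv _ ⟨s, hs, rfl⟩⟩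

/-- A commuting family of `2 × 2` matrices over an algebraically closed field is simultaneously
upper triangularisable: some `P ∈ GL₂` makes every `P s P⁻¹` have vanishing `(1,0)` entry. [folklore] -/
theorem exists_conj_upperTriangular_fin_two (S : Set (Matrix (Fin 2) (Fin 2) F))
    (hS : ∀ s ∈ S, ∀ t ∈ S, s * t = t * s) :
    ∃ P : GL (Fin 2) F, ∀ s ∈ S,
      ((P : Matrix (Fin 2) (Fin 2) F) * s * ((P⁻¹ : GL (Fin 2) F) : Matrix (Fin 2) (Fin 2) F)) 1 0
        = 0 := by
  obtain ⟨v, hv0, hv⟩ := exists_common_eigenvector_fin_two S hS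
  obtain ⟨Q, hQ⟩ := ModPGaloisRep.InertiaShape.exists_gl_mulVec_single_zero_eq v hv0
  refine ⟨Q⁻¹, fun s hs => ?_⟩
  obtain ⟨c, hc⟩ := hv s hs
  have h2 := ModPGaloisRep.InertiaShape.apply_of_mulVec_single_eq_smul
    (ModPGaloisRep.InertiaShape.conj_mulVec_single_zero (M := s) hQ hc) 1
  rw [inv_inv]
  simpa using h2

end TwoByTwo

/-! ### Local Galois groups: commutators are inertial -/

/-- `[Γ_F, Γ_F] ≤ I_F` for a non-archimedean local field `F`: commutators of `Γ_F` lie in the inertia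
group (tree: closure of `[Γ_F, Γ_F]` is inertial, by density of the Weil group). [folklore] -/
theorem commutatorElement_mem_absInertia (F : Type*) [Field F] [ValuativeRel F] [TopologicalSpace F]
    [IsNonarchimedeanLocalField F] (σ τ : Field.absoluteGaloisGroup F) : ⁅σ, τ⁆ ∈ absInertia F :=
  WeilGroup.topologicalClosure_commutator_absGalois_le_absInertia
    (WeilGroup.denseRange_toAbsGalois_holds F)
    (Subgroup.le_topologicalClosure _
      (Subgroup.commutator_mem_commutator (Subgroup.mem_top σ) (Subgroup.mem_top τ)))

/-! ### Linear algebra: a basis adapted to a plane in a four-dimensional space -/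

/-- A basis of a `4`-dimensional space whose last two vectors span a given plane `W`: the vectors of
index `≥ 2` lie in `W` and the first two coordinates of every element of `W` vanish. [folklore] -/
theorem exists_basis_adapted {k V : Type*} [Field k] [AddCommGroup V] [Module k V]
    [FiniteDimensional k V] (hV : Module.finrank k V = 4) (W : Submodule k V)
    (hW : Module.finrank k W = 2) :
    ∃ b : Module.Basis (Fin 4) k V, (∀ i : Fin 2, b (Fin.natAdd 2 i) ∈ W) ∧
      ∀ x ∈ W, ∀ i : Fin 2, b.repr x (Fin.castAdd 2 i) = 0 := by
  obtain ⟨W', hc⟩ := W.exists_isCompl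
  have hW' : Module.finrank k W' = 2 := by
    have := Submodule.finrank_add_eq_of_isCompl hc; omega
  let e : (W' × W) ≃ₗ[k] V := Submodule.prodEquivOfIsCompl W' W hc.symm
  let b₀ : Module.Basis (Fin 2 ⊕ Fin 2) k V :=
    ((Module.finBasisOfFinrankEq k W' hW').prod (Module.finBasisOfFinrankEq k W hW)).map e
  refine ⟨b₀.reindex finSumFinEquiv, fun i => ?_, fun x hx i => ?_⟩
  · rw [Module.Basis.reindex_apply, finSumFinEquiv_symm_apply_natAdd]
    simp [b₀, e]
  · rw [Module.Basis.repr_reindex_apply, finSumFinEquiv_symm_apply_castAdd]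
    simp [b₀, e, Submodule.prodEquivOfIsCompl_symm_apply_right W' W hc.symm ⟨x, hx⟩]

/-! ### The stub, conditional on the cited fact -/

/-- **Stub 3ii (`stub_tateModuleGreenberg`), conditional on the cited fact
`ordinaryReduction_tateModule_filtration`.**  For an abelian surface `B/ℚ` with good ordinary
reduction at `v ∣ p`, the framed `H¹ = (V_p B)^∨ ⊗ ℚ̄_p` (`ρ₀(g) = [g⁻¹]_bᵀ`) is Greenberg-ordinary
of shape `(0,0,1,1)` at `v`: dualising the ordinary filtration `W ⊂ V_p(B)` gives an unramified
rank-2 sub `W^⊥` and the quotient `W^∨ = χ⁻¹ ⊗ (unramified)`; the two blocks are triangularised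
over `ℚ̄_p` as commuting families (`[Γ_v, Γ_v] ≤ I_v`, inertia scalar on each block).  The
conclusion is the registered signature verbatim.
[cite: Greenberg1991, §2] [cite: BoxerEtAl2021, §7.3 (p-distinguished weight 2 ordinary)] -/
theorem stub_tateModuleGreenberg :
    Literature.NumberTheory.DiophantineGeometry.ordinaryReduction_tateModule_filtration →
    ∀ (p : ℕ) [Fact p.Prime] (B : AbelianVariety ℚ)
      (b : Module.Basis (Fin 4) ℚ_[p] (B.rationalTateModule p)) (ρ₀ : FramedGaloisRep ℚ (PadicAlgCl p) 4),
      (∀ g : Field.absoluteGaloisGroup ℚ,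
        (ρ₀ g).val =
          ((LinearMap.toMatrix b b (B.rationalTateRep p g⁻¹)).map
            (algebraMap ℚ_[p] (PadicAlgCl p))).transpose) →
      B.dim = 2 →
      ∀ v : HeightOneSpectrum (𝓞 ℚ), ((p : ℕ) : 𝓞 ℚ) ∈ v.asIdeal → B.HasGoodOrdinaryReductionAt v →
        ρ₀.IsGreenbergOrdinaryOfShapeAt v ![0, 0, 1, 1] := by
  intro hST p _ B b ρ₀ hfr hdim v hv hord
  obtain ⟨W, hWdim, hWstab, hWI, hWquot⟩ := hST B v p hv hord
  set ρ := B.rationalTateRep p with hρ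
  set r := absGaloisRestrict ℚ (v.adicCompletion ℚ) with hr
  set χ := GaloisRep.cyclotomicCharacter (v.adicCompletion ℚ) p with hχ
  haveI : FiniteDimensional ℚ_[p] (B.rationalTateModule p) := Module.Finite.of_basis b
  have hV4 : Module.finrank ℚ_[p] (B.rationalTateModule p) = 4 := by
    simpa using Module.finrank_eq_card_basis b
  rw [hdim] at hWdim
  obtain ⟨b', hb'W, hb'repr⟩ := exists_basis_adapted hV4 W hWdim
  -- the matrices of `Γ_ℚ` in the adapted basis
  set A' : Field.absoluteGaloisGroup ℚ → Matrix (Fin 4) (Fin 4) ℚ_[p] :=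
    fun σ => LinearMap.toMatrix b' b' (ρ σ) with hA'
  have hA'mul : ∀ σ σ', A' (σ * σ') = A' σ * A' σ' := fun σ σ' => by
    simp only [A', map_mul, LinearMap.toMatrix_mul]
  have hF1 : ∀ (τ' : Field.absoluteGaloisGroup (v.adicCompletion ℚ)) (i j : Fin 2),
      A' (r τ') (Fin.castAdd 2 j) (Fin.natAdd 2 i) = 0 := fun τ' i j => by
    simp only [A', LinearMap.toMatrix_apply]
    exact hb'repr _ (hWstab τ' _ (hb'W i)) j
  have hF2 : ∀ τ' ∈ absInertia (v.adicCompletion ℚ), ∀ (i : Fin 2) (k : Fin 4),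
      A' (r τ') k (Fin.natAdd 2 i) =
        if Fin.natAdd 2 i = k then (((χ τ' : ℤ_[p]ˣ) : ℤ_[p]) : ℚ_[p]) else 0 := by
    intro τ' hτ' i k
    simp only [A', LinearMap.toMatrix_apply]
    rw [hWI τ' hτ' _ (hb'W i), map_smul, Module.Basis.repr_self, Finsupp.smul_apply,
      Finsupp.single_apply, smul_eq_mul, mul_ite, mul_one, mul_zero]
  have hF3 : ∀ τ' ∈ absInertia (v.adicCompletion ℚ), ∀ (k : Fin 4) (j : Fin 2),
      A' (r τ') (Fin.castAdd 2 j) k = if k = Fin.castAdd 2 j then 1 else 0 := by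
    intro τ' hτ' k j
    simp only [A', LinearMap.toMatrix_apply]
    have h := hb'repr _ (hWquot τ' hτ' (b' k)) j
    rw [map_sub, Finsupp.sub_apply, sub_eq_zero] at h
    rw [h, Module.Basis.repr_self, Finsupp.single_apply]
  -- change of frame from the dual basis of `b` to the dual basis of `b'`
  set fM := (algebraMap ℚ_[p] (PadicAlgCl p)).mapMatrix (m := Fin 4) with hfM
  set C := b.toMatrix b' with hC
  set C' := b'.toMatrix b with hC'
  have hCC' : C * C' = 1 := b.toMatrix_mul_toMatrix_flip b'
  have hC'C : C' * C = 1 := b'.toMatrix_mul_toMatrix_flip b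
  have hA : ∀ σ, LinearMap.toMatrix b b (ρ σ) = C * A' σ * C' := fun σ =>
    (basis_toMatrix_mul_linearMap_toMatrix_mul_basis_toMatrix b b' b b' (ρ σ)).symm
  let g₁ : GL (Fin 4) (PadicAlgCl p) :=
    ⟨(fM C).transpose, (fM C').transpose,
      by rw [← Matrix.transpose_mul, ← map_mul, hC'C, map_one, Matrix.transpose_one],
      by rw [← Matrix.transpose_mul, ← map_mul, hCC', map_one, Matrix.transpose_one]⟩
  set N' : Field.absoluteGaloisGroup (v.adicCompletion ℚ) → Matrix (Fin 4) (Fin 4) (PadicAlgCl p) :=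
    fun τ => (fM (A' (r τ)⁻¹)).transpose with hN'
  have hN0 : ∀ τ, ((g₁ * ρ₀.toLocal v τ * g₁⁻¹ : GL (Fin 4) (PadicAlgCl p)) :
      Matrix (Fin 4) (Fin 4) (PadicAlgCl p)) = N' τ := by
    intro τ
    rw [Units.val_mul, Units.val_mul]
    change (fM C).transpose * ((ρ₀ (r τ) : GL (Fin 4) (PadicAlgCl p)) : Matrix _ _ _) *
      (fM C').transpose = (fM (A' (r τ)⁻¹)).transpose
    rw [hfr (r τ), hA]
    change (fM C).transpose * (fM (C * A' (r τ)⁻¹ * C')).transpose * (fM C').transpose = _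
    rw [← Matrix.transpose_mul, ← Matrix.transpose_mul, ← map_mul, ← map_mul]
    congr 2
    rw [Matrix.mul_assoc, Matrix.mul_assoc, hC'C, Matrix.mul_one, ← Matrix.mul_assoc, hC'C,
      Matrix.one_mul]
  have hN1 : ∀ τ σ, N' (τ * σ) = N' τ * N' σ := fun τ σ => by
    simp only [N', map_mul, mul_inv_rev, hA'mul, Matrix.transpose_mul]
  have hN'apply : ∀ τ i j, N' τ i j = algebraMap ℚ_[p] (PadicAlgCl p) (A' (r τ⁻¹) j i) := by
    intro τ i j
    rw [map_inv]
    rfl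
  have hN2 : ∀ τ (i j : Fin 2), N' τ (Fin.natAdd 2 i) (Fin.castAdd 2 j) = 0 := fun τ i j => by
    rw [hN'apply, hF1, map_zero]
  have hN3 : ∀ τ ∈ absInertia (v.adicCompletion ℚ), ∀ (k : Fin 4) (j : Fin 2),
      N' τ k (Fin.castAdd 2 j) = if k = Fin.castAdd 2 j then 1 else 0 := by
    intro τ hτ k j
    rw [hN'apply, hF3 _ (inv_mem hτ)]
    split_ifs <;> simp
  set c : Field.absoluteGaloisGroup (v.adicCompletion ℚ) → PadicAlgCl p :=
    fun τ => algebraMap ℚ_[p] (PadicAlgCl p) ((((χ τ)⁻¹ : ℤ_[p]ˣ) : ℤ_[p]) : ℚ_[p]) with hc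
  have hN4 : ∀ τ ∈ absInertia (v.adicCompletion ℚ), ∀ (i j : Fin 2),
      N' τ (Fin.natAdd 2 i) (Fin.natAdd 2 j) = if i = j then c τ else 0 := by
    intro τ hτ i j
    rw [hN'apply, hF2 _ (inv_mem hτ), map_inv]
    by_cases hij : i = j
    · subst hij; simp [c]
    · rw [if_neg (fun h => hij ((Fin.natAdd_inj 2).mp h)), if_neg hij, map_zero]
  -- `2 + 2` block bookkeeping (`e4 : Fin 2 ⊕ Fin 2 ≃ Fin 4`)
  set e4 : Fin 2 ⊕ Fin 2 ≃ Fin 4 := finSumFinEquiv with he4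
  have he_inl : ∀ i, e4 (Sum.inl i) = Fin.castAdd 2 i := fun _ => rfl
  have he_inr : ∀ i, e4 (Sum.inr i) = Fin.natAdd 2 i := fun _ => rfl
  have hblk0 : ∀ τ, (N' τ).submatrix e4 e4 = Matrix.fromBlocks ((N' τ).submatrix e4 e4).toBlocks₁₁
      ((N' τ).submatrix e4 e4).toBlocks₁₂ 0 ((N' τ).submatrix e4 e4).toBlocks₂₂ := fun τ => by
    have h21 : ((N' τ).submatrix e4 e4).toBlocks₂₁ = 0 := by
      ext i j
      simp only [Matrix.toBlocks₂₁, Matrix.of_apply, Matrix.submatrix_apply, he_inr, he_inl, hN2,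
        Matrix.zero_apply]
    rw [← h21, Matrix.fromBlocks_toBlocks]
  set TL := fun τ => ((N' τ).submatrix e4 e4).toBlocks₁₁ with hTL
  set TR := fun τ => ((N' τ).submatrix e4 e4).toBlocks₁₂ with hTR
  set BR := fun τ => ((N' τ).submatrix e4 e4).toBlocks₂₂ with hBR
  have hblk' : ∀ τ, (N' τ).submatrix e4 e4 = Matrix.fromBlocks (TL τ) (TR τ) 0 (BR τ) := hblk0
  have hblk : ∀ τ, N' τ = (Matrix.fromBlocks (TL τ) (TR τ) 0 (BR τ)).submatrix e4.symm e4.symm :=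
    fun τ => by rw [← hblk']; simp [Matrix.submatrix_submatrix]
  have hca : ∀ i j : Fin 2, (Fin.castAdd 2 i : Fin 4) = Fin.castAdd 2 j ↔ i = j := fun i j =>
    Fin.castAdd_inj
  have hTL1 : ∀ τ ∈ absInertia (v.adicCompletion ℚ), TL τ = 1 := fun τ hτ => by
    ext i j
    simp only [TL, Matrix.toBlocks₁₁, Matrix.of_apply, Matrix.submatrix_apply, he_inl, hN3 τ hτ,
      Matrix.one_apply, hca]
  have hBRc : ∀ τ ∈ absInertia (v.adicCompletion ℚ), BR τ = c τ • (1 : Matrix (Fin 2) (Fin 2) _) :=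
    fun τ hτ => by
    ext i j
    simp only [BR, Matrix.toBlocks₂₂, Matrix.of_apply, Matrix.submatrix_apply, he_inr, hN4 τ hτ,
      Matrix.smul_apply, Matrix.one_apply, smul_eq_mul, mul_ite, mul_one, mul_zero]
  have hmul : ∀ τ σ, TL (τ * σ) = TL τ * TL σ ∧ BR (τ * σ) = BR τ * BR σ := fun τ σ => by
    have h : (N' (τ * σ)).submatrix e4 e4 = (N' τ).submatrix e4 e4 * (N' σ).submatrix e4 e4 := by
      rw [hN1, Matrix.submatrix_mul_equiv]
    rw [hblk', hblk', hblk', Matrix.fromBlocks_multiply] at h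
    simp only [Matrix.mul_zero, Matrix.zero_mul, add_zero, zero_add] at h
    obtain ⟨h11, -, -, h22⟩ := Matrix.fromBlocks_inj.mp h
    exact ⟨h11, h22⟩
  have hcommI : ∀ τ σ : Field.absoluteGaloisGroup (v.adicCompletion ℚ),
      ⁅τ, σ⁆ ∈ absInertia (v.adicCompletion ℚ) := commutatorElement_mem_absInertia _
  have hcomm_eq : ∀ τ σ : Field.absoluteGaloisGroup (v.adicCompletion ℚ), τ * σ = ⁅τ, σ⁆ * (σ * τ) :=
    fun τ σ => by group
  have hc1 : ∀ τ σ : Field.absoluteGaloisGroup (v.adicCompletion ℚ), c ⁅τ, σ⁆ = 1 := fun τ σ => by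
    have hχ1 : χ ⁅τ, σ⁆ = 1 := by
      rw [map_commutatorElement, commutatorElement_eq_one_iff_mul_comm, mul_comm]
    simp [c, hχ1]
  have hTLcomm : ∀ τ σ, TL τ * TL σ = TL σ * TL τ := fun τ σ => by
    rw [← (hmul τ σ).1, hcomm_eq τ σ, (hmul _ _).1, hTL1 _ (hcommI τ σ), Matrix.one_mul,
      (hmul σ τ).1]
  have hBRcomm : ∀ τ σ, BR τ * BR σ = BR σ * BR τ := fun τ σ => by
    rw [← (hmul τ σ).2, hcomm_eq τ σ, (hmul _ _).2, hBRc _ (hcommI τ σ), hc1, one_smul,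
      Matrix.one_mul, (hmul σ τ).2]
  obtain ⟨X, hX⟩ := exists_conj_upperTriangular_fin_two (Set.range TL)
    (by rintro _ ⟨τ, rfl⟩ _ ⟨σ, rfl⟩; exact hTLcomm τ σ)
  obtain ⟨Y, hY⟩ := exists_conj_upperTriangular_fin_two (Set.range BR)
    (by rintro _ ⟨τ, rfl⟩ _ ⟨σ, rfl⟩; exact hBRcomm τ σ)
  -- the Greenberg frame `diag(X, Y) · g₁`
  let D : GL (Fin 4) (PadicAlgCl p) :=
    ⟨(Matrix.fromBlocks X.val 0 0 Y.val).submatrix e4.symm e4.symm,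
      (Matrix.fromBlocks (X⁻¹).val 0 0 (Y⁻¹).val).submatrix e4.symm e4.symm,
      by simp [Matrix.submatrix_mul_equiv, Matrix.fromBlocks_multiply],
      by simp [Matrix.submatrix_mul_equiv, Matrix.fromBlocks_multiply]⟩
  have hDval : (D : Matrix (Fin 4) (Fin 4) (PadicAlgCl p)) =
      (Matrix.fromBlocks X.val 0 0 Y.val).submatrix e4.symm e4.symm := rfl
  have hDinv : ((D⁻¹ : GL (Fin 4) (PadicAlgCl p)) : Matrix (Fin 4) (Fin 4) (PadicAlgCl p)) =
      (Matrix.fromBlocks (X⁻¹).val 0 0 (Y⁻¹).val).submatrix e4.symm e4.symm := rfl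
  have hZ : ∀ τ, ((D * g₁ * ρ₀.toLocal v τ * (D * g₁)⁻¹ : GL (Fin 4) (PadicAlgCl p)) :
      Matrix (Fin 4) (Fin 4) (PadicAlgCl p)) =
      (Matrix.fromBlocks (X.val * TL τ * (X⁻¹).val) (X.val * TR τ * (Y⁻¹).val) 0
        (Y.val * BR τ * (Y⁻¹).val)).submatrix e4.symm e4.symm := fun τ => by
    have : D * g₁ * ρ₀.toLocal v τ * (D * g₁)⁻¹ = D * (g₁ * ρ₀.toLocal v τ * g₁⁻¹) * D⁻¹ := by
      group
    rw [this, Units.val_mul, Units.val_mul, hN0 τ, hblk τ, hDval, hDinv]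
    simp [Matrix.submatrix_mul_equiv, Matrix.fromBlocks_multiply, Matrix.mul_assoc]
  have he0 : e4.symm 0 = Sum.inl 0 := e4.symm_apply_eq.mpr rfl
  have he1 : e4.symm 1 = Sum.inl 1 := e4.symm_apply_eq.mpr rfl
  have he2 : e4.symm 2 = Sum.inr 0 := e4.symm_apply_eq.mpr rfl
  have he3 : e4.symm 3 = Sum.inr 1 := e4.symm_apply_eq.mpr rfl
  refine ⟨D * g₁, fun τ i j hij => ?_, fun τ hτ i => ?_, fun τ hτ i j hij ha => ?_⟩
  · have h1 := hX _ ⟨τ, rfl⟩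
    have h2 := hY _ ⟨τ, rfl⟩
    simp only [Matrix.coe_units_inv] at h1 h2
    rw [hZ τ]
    fin_cases i <;> fin_cases j <;> simp at hij <;>
      simp [Matrix.submatrix_apply, he0, he1, he2, he3, h1, h2]
  · have hcdef : ∀ τ, c τ =
        algebraMap ℚ_[p] (PadicAlgCl p) ((((χ τ)⁻¹ : ℤ_[p]ˣ) : ℤ_[p]) : ℚ_[p]) := fun _ => rfl
    rw [hZ τ, hTL1 τ hτ, hBRc τ hτ]
    fin_cases i <;>
      simp [Matrix.submatrix_apply, he0, he1, he2, he3, hcdef, ← hχ, Algebra.algebraMap_eq_smul_one]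
  · rw [hZ τ, hTL1 τ hτ, hBRc τ hτ]
    fin_cases i <;> fin_cases j <;> simp at hij ha <;>
      simp [Matrix.submatrix_apply, he0, he1, he2, he3]

end Summit.Langlands.Langlands.Cruxes.StableYoshidaCongruence.LevelThreeWeierstrassSwitch
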